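import Summits.NavierStokesRegularity.NavierStokesRegularity.Theorems.LerayQuarterDissipationFiniteDissipationLiouvilleApexUniform
import Summits.NavierStokesRegularity.NavierStokesRegularity.Theorems.LerayQuarterDissipationFiniteDissipationLiouvilleFinalTrace
import HarnessLib

/-!
# Crux `FiniteDissipationLiouville` (stmt-NavierStokesRegularity-22144): the final datum of every
# member of the stratum lies in the CRITICAL MORREY CLASS `M^{2,1}`, with a constant depending on
# the dissipation constant `K` only — no energy concentrates at the singular time

Theorems file of route `LerayQuarterDissipation` (lead prover g5; `--supports` the crux: a portrait
constraint on the final datum, bearing on both registered stubs of the line `birth`). Navier–Stokes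
regularity is NOT proved by anything here; no summit is.

`𝒟_{C,K}`: Type-I ancient mild fields `u` in the KNSS gauge (`IsTypeIAncientMild C u`) with Leray's
quarter-rate dissipation law `∫ ‖∇u(s)‖² ≤ K/√(−s)`. Lead g3 proved the scale-invariant energy
bound `A(r; (0, x₀)) ≤ Λ` at every top point and EVERY scale (`exists_scaledEnergy_bound`,
Chae–Wolf 2017 §2 Step 2 at `q = 6`) and the existence of the distributional trace
`L_φ = lim_{t→0⁻} ∫⟪u(t), φ⟫` (`exists_tendsto_pairing_finalSlice`).

* `exists_scaledEnergy_bound_unif` — the constant `Λ` can be chosen BEFORE the member and depends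
  on `K` only (not on the Type-I constant `C`): the Chae–Wolf bound sees only the `L⁶` rate
  `‖u(t)‖₆ ≤ C_L √(K⁺) (−t)^{−1/4}` (`exists_eLpNorm_six_rate_unif`, lead g3).
* `ae_lintegral_ball_sq_le_unif` — **no energy concentration at the singular time**: for every
  member of `𝒟_{C,K}`, every centre `x₀` and radius `r > 0`,
  `∫_{B(x₀,r)} |u(t)|² ≤ Λ(K) r` for a.e. `t ∈ (−r², 0)`. The local energy near a singular point
  tends to `0` with the radius, uniformly up to the singular time: a Type-I dissipation-law
  singularity carries NO ATOM OF ENERGY (contrast: the concentration measure of a general suitable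
  weak solution at a singular time).
* `abs_trace_le_morrey` / `exists_trace_morrey_bound` — **THE FINAL DATUM IS IN `M^{2,1}`,
  UNIFORMLY**: there is `M = M(K)` with `|L_φ| ≤ M √r ‖φ‖_{L²}` for every member of every
  `𝒟_{C,K}`, every ball `B(x₀, r)` and every test field `φ` supported in it — at EVERY point,
  singular or not. So `u(0⁻)` is an `L²_loc` FUNCTION with `‖u(0⁻)‖_{L²(B(x₀,r))} ≤ M √r`: the
  Morrey–Campanato scaling of the homogeneous profile `|x|⁻¹` (the DSS final data of the wall stub
  `stub_typeIDSSLiouvilleWall` are exactly of this kind, lead g3 `trace_pastDss_homogeneous`), and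
  the sharp complement of lead g4's `eq_zero_of_pastDss_of_trace_lq_dual` (a past-DSS member with
  trace in `L^p(B(0,r₀))`, `p > 3`, is trivial): on `𝒟` the trace of a singular member sits in
  `M^{2,1} ∖ ⋃_{p>3} L^p_loc(apex)`. With lead g4 (`trace_bounded_off_singularSet`,
  `exists_finite_singularSet`) and this lead's far-field trace leaf (`…TraceSupport`): **the final
  datum of a singular member of `𝒟_{C,K}` is an `L²_{uloc} ∩ M^{2,1}` function of norm `≤ M(K)`,
  bounded off at most `c(K⁺)³` points, with unbounded support** — an admissible datum of
  Lemarié-Rieusset's `L²_{uloc}` local Leray theory, through which the flow continues weakly past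
  the singular time.
* `abs_le_of_tendsto_of_ae_abs_le` — the real-variable step: a limit along `t → 0⁻` of a function
  bounded a.e. on `(a, 0)` obeys the bound.

References: D. Chae, J. Wolf, arXiv:1610.09464, §2 Step 2 ((2.17)); P. G. Lemarié-Rieusset,
*The Navier–Stokes Problem in the 21st Century* (2016), Ch. 14.
-/

noncomputable section

-- the summit and its single sub-problem share the name (CONVENTIONS §1), as in every Theorems file
set_option linter.dupNamespace false

namespace Summit.NavierStokesRegularity.NavierStokesRegularity.Theorems.FiniteDissipationLiouville.Birth.Apex

open MeasureTheory Set Filter Topology Metric Function TopologicalSpace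
open Literature.Analysis Literature.Analysis.FluidPDE
open scoped ENNReal NNReal RealInnerProductSpace

variable {C K : ℝ} {u : ℝ → EuclideanSpace ℝ (Fin 3) → EuclideanSpace ℝ (Fin 3)}

/-! ### The scale-invariant energy bound with a constant depending on `K` only -/

/-- **Albritton–Barker's `A` and `E` at every top point and scale, constant chosen before the
member and depending on `K` only.** For every `K` there is `Λ` with `A(r; (0, x₀)) ≤ Λ` and
`E(r; (0, x₀)) ≤ Λ` for every member `u` of every stratum `𝒟_{C,K}`, every `x₀` and every `r > 0`
(`ChaeWolfDecay.exists_scaleInvariant_energy_bound` at `q = 6` fed with the universal `L⁶` rate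
`exists_eLpNorm_six_rate_unif`). -/
theorem exists_scaledEnergy_bound_unif (K : ℝ) :
    ∃ Λ : ℝ≥0, ∀ (C : ℝ) (u : ℝ → EuclideanSpace ℝ (Fin 3) → EuclideanSpace ℝ (Fin 3)),
      IsTypeIAncientMild C u →
      (∀ s : ℝ, s < 0 → ∫⁻ x, ‖fderiv ℝ (u s) x‖ₑ ^ 2 ≤ ENNReal.ofReal (K / Real.sqrt (-s))) →
      ∀ (x₀ : EuclideanSpace ℝ (Fin 3)) (r : ℝ), 0 < r →
        cknAEss r ((0 : ℝ), x₀) u ≤ Λ ∧ cknE r ((0 : ℝ), x₀) (fun t x => fderiv ℝ (u t) x) ≤ Λ := by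
  obtain ⟨CL, hCL, hsix⟩ := exists_eLpNorm_six_rate_unif
  have hA0 : 0 ≤ CL * Real.sqrt (max K 0) := by positivity
  obtain ⟨Λ, hΛ⟩ := ChaeWolfDecay.exists_scaleInvariant_energy_bound (q := 6) (by norm_num) hA0
  refine ⟨Λ, fun C u hu hlaw x₀ r hr => ?_⟩
  obtain ⟨p, hp⟩ := exists_isClassicalNSSolutionOn_Iio hu
  exact hΛ u p hp (fun t ht => (hsix C K u hu hlaw t ht).1)
    (fun t ht => (hsix C K u hu hlaw t ht).2) x₀ r hr

/-! ### No energy concentration at the singular time -/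

/-- **No atom of energy at the singular time, uniformly on `𝒟_{C,K}`.** For every `K` there is
`Λ` such that every member `u` of every `𝒟_{C,K}` satisfies
`∫_{B(x₀,r)} |u(t)|² ≤ r Λ` for a.e. `t ∈ (−r², 0)`, every centre `x₀` and every `r > 0`. -/
theorem ae_lintegral_ball_sq_le_unif (K : ℝ) :
    ∃ Λ : ℝ≥0, ∀ (C : ℝ) (u : ℝ → EuclideanSpace ℝ (Fin 3) → EuclideanSpace ℝ (Fin 3)),
      IsTypeIAncientMild C u →
      (∀ s : ℝ, s < 0 → ∫⁻ x, ‖fderiv ℝ (u s) x‖ₑ ^ 2 ≤ ENNReal.ofReal (K / Real.sqrt (-s))) →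
      ∀ (x₀ : EuclideanSpace ℝ (Fin 3)) (r : ℝ), 0 < r →
        ∀ᵐ t ∂(volume.restrict (Ioo (-r ^ 2) 0)),
          ∫⁻ x in ball x₀ r, ‖u t x‖ₑ ^ 2 ≤ ENNReal.ofReal r * Λ := by
  obtain ⟨Λ, hΛ⟩ := exists_scaledEnergy_bound_unif K
  refine ⟨Λ, fun C u hu hlaw x₀ r hr => ?_⟩
  have hrne : ENNReal.ofReal r ≠ 0 := (ENNReal.ofReal_pos.2 hr).ne'
  have h1 := (hΛ C u hu hlaw x₀ r hr).1
  unfold cknAEss at h1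
  simp only [zero_sub] at h1
  have h2 := ENNReal.ae_le_essSup (μ := volume.restrict (Ioo (-r ^ 2) (0 : ℝ)))
    (fun t => (ENNReal.ofReal r)⁻¹ * ∫⁻ x in ball x₀ r, ‖u t x‖ₑ ^ 2)
  filter_upwards [h2] with t ht
  have h3 := ht.trans h1
  calc ∫⁻ x in ball x₀ r, ‖u t x‖ₑ ^ 2
      = ENNReal.ofReal r * ((ENNReal.ofReal r)⁻¹ * ∫⁻ x in ball x₀ r, ‖u t x‖ₑ ^ 2) := by
        rw [← mul_assoc, ENNReal.mul_inv_cancel hrne ENNReal.ofReal_ne_top, one_mul]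
    _ ≤ ENNReal.ofReal r * Λ := mul_le_mul_right h3 _

/-- **No atom of energy at the singular time — at EVERY time.** The a.e. bound of
`ae_lintegral_ball_sq_le_unif` holds at every `t ∈ (−r², 0)`: the good times are dense (full
measure) and `t ↦ ∫_{B(x₀,r)} |u(t)|²` is lower semicontinuous along sequences (Fatou; the slices
are continuous in `t`). So for every member of every `𝒟_{C,K}`, every `x₀` and `r > 0`:
`sup_{t ∈ (−r²,0)} ∫_{B(x₀,r)} |u(t)|² ≤ Λ(K) r` — the local energy around any point, singular or
not, is `O(r)` uniformly up to the singular time. -/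
theorem lintegral_ball_sq_le_unif (K : ℝ) :
    ∃ Λ : ℝ≥0, ∀ (C : ℝ) (u : ℝ → EuclideanSpace ℝ (Fin 3) → EuclideanSpace ℝ (Fin 3)),
      IsTypeIAncientMild C u →
      (∀ s : ℝ, s < 0 → ∫⁻ x, ‖fderiv ℝ (u s) x‖ₑ ^ 2 ≤ ENNReal.ofReal (K / Real.sqrt (-s))) →
      ∀ (x₀ : EuclideanSpace ℝ (Fin 3)) (r : ℝ), 0 < r →
        ∀ t ∈ Ioo (-r ^ 2) 0, ∫⁻ x in ball x₀ r, ‖u t x‖ₑ ^ 2 ≤ ENNReal.ofReal r * Λ := by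
  obtain ⟨Λ, hΛ⟩ := ae_lintegral_ball_sq_le_unif K
  refine ⟨Λ, fun C u hu hlaw x₀ r hr t₀ ht₀ => ?_⟩
  have hae := hΛ C u hu hlaw x₀ r hr
  -- the good times are frequent near `t₀`
  set G : Set ℝ := {t | t < 0 ∧ ∫⁻ x in ball x₀ r, ‖u t x‖ₑ ^ 2 ≤ ENNReal.ofReal r * Λ} with hG
  have hfreq : ∃ᶠ t in 𝓝 t₀, t ∈ G := by
    by_contra hnot
    rw [Filter.not_frequently] at hnot
    obtain ⟨ε, hε, hball⟩ := Metric.eventually_nhds_iff.1 hnot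
    -- the interval `(a, b) ⊆ (t₀ - ε, t₀ + ε) ∩ (−r², 0)` has positive measure and misses `G`
    set a : ℝ := max (t₀ - ε / 2) (-r ^ 2) with ha
    set b : ℝ := min (t₀ + ε / 2) 0 with hb
    have hab : a < b := by
      rw [ha, hb]
      exact max_lt (lt_min (by linarith) (by linarith [ht₀.2]))
        (lt_min (by linarith [ht₀.1]) (by linarith [ht₀.1, ht₀.2]))
    have hIsub : Ioo a b ⊆ Ioo (-r ^ 2) 0 := Ioo_subset_Ioo (le_max_right _ _) (min_le_right _ _)
    have hImiss : ∀ t ∈ Ioo a b, t ∉ G := fun t ht => by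
      refine hball ?_
      rw [Real.dist_eq, abs_lt]
      constructor
      · linarith [(le_max_left _ _ : t₀ - ε / 2 ≤ a), ht.1]
      · linarith [(min_le_left _ _ : b ≤ t₀ + ε / 2), ht.2]
    have hnull : volume.restrict (Ioo (-r ^ 2) 0) {t | ¬ (∫⁻ x in ball x₀ r, ‖u t x‖ₑ ^ 2 ≤
        ENNReal.ofReal r * Λ)} = 0 := ae_iff.1 hae
    have hsub' : Ioo a b ⊆ {t | ¬ (∫⁻ x in ball x₀ r, ‖u t x‖ₑ ^ 2 ≤ ENNReal.ofReal r * Λ)} :=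
      fun t ht hle => hImiss t ht ⟨(hIsub ht).2, hle⟩
    have hzero : volume.restrict (Ioo (-r ^ 2) 0) (Ioo a b) = 0 := measure_mono_null hsub' hnull
    rw [Measure.restrict_apply measurableSet_Ioo, inter_eq_left.2 hIsub, Real.volume_Ioo] at hzero
    exact (ENNReal.ofReal_pos.2 (sub_pos.2 hab)).ne' hzero
  -- a sequence of good times tending to `t₀`
  obtain ⟨s, hsG, hs⟩ := mem_closure_iff_seq_limit.1 (mem_closure_iff_frequently.2 hfreq)
  -- Fatou along the sequence
  have hmeas : ∀ n, Measurable fun x => ‖u (s n) x‖ₑ ^ 2 := fun n =>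
    ((ENNReal.continuous_pow 2).comp (hu.continuous_slice (hsG n).1).enorm).measurable
  have hpt : ∀ x, Tendsto (fun n => ‖u (s n) x‖ₑ ^ 2) atTop (𝓝 (‖u t₀ x‖ₑ ^ 2)) := by
    intro x
    have hcont : ContinuousAt (uncurry u) (t₀, x) :=
      hu.continuousOn_uncurry.continuousAt
        ((isOpen_Iio.prod isOpen_univ).mem_nhds ⟨ht₀.2, mem_univ x⟩)
    have h1 : Tendsto (fun n => uncurry u (s n, x)) atTop (𝓝 (uncurry u (t₀, x))) :=
      hcont.tendsto.comp (hs.prodMk_nhds tendsto_const_nhds)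
    exact (((ENNReal.continuous_pow 2).comp continuous_enorm).tendsto _).comp h1
  calc ∫⁻ x in ball x₀ r, ‖u t₀ x‖ₑ ^ 2
      = ∫⁻ x in ball x₀ r, liminf (fun n => ‖u (s n) x‖ₑ ^ 2) atTop := by
        refine lintegral_congr fun x => ?_
        rw [(hpt x).liminf_eq]
    _ ≤ liminf (fun n => ∫⁻ x in ball x₀ r, ‖u (s n) x‖ₑ ^ 2) atTop := lintegral_liminf_le hmeas
    _ ≤ ENNReal.ofReal r * Λ :=
        liminf_le_of_frequently_le' (Frequently.of_forall fun n => (hsG n).2)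

/-! ### Real-variable step: limits along `t → 0⁻` of a.e.-bounded functions -/

/-- **A limit along `t → 0⁻` of a function bounded a.e. on `(a, 0)` obeys the bound**: if
`F(t) → L` as `t ↑ 0` and `|F| ≤ B` a.e. on `(a, 0)`, `a < 0`, then `|L| ≤ B` (otherwise
`|F| > B` on a whole interval `(l, 0)`, a set of positive measure). -/
theorem abs_le_of_tendsto_of_ae_abs_le {F : ℝ → ℝ} {L B a : ℝ} (ha : a < 0)
    (hF : Tendsto F (𝓝[<] 0) (𝓝 L))
    (hB : ∀ᵐ t ∂(volume.restrict (Ioo a 0)), |F t| ≤ B) : |L| ≤ B := by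
  by_contra hlt
  push Not at hlt
  have hev : ∀ᶠ t in 𝓝[<] (0 : ℝ), B < |F t| :=
    ((continuous_abs.tendsto L).comp hF).eventually_const_lt hlt
  obtain ⟨l, hl, hsub⟩ := mem_nhdsLT_iff_exists_Ioo_subset.1 hev
  have hl0 : l < 0 := hl
  -- the a.e. bound fails on `(max a l, 0)`, a set of positive measure
  have hnull : volume.restrict (Ioo a 0) {t | ¬ |F t| ≤ B} = 0 := ae_iff.1 hB
  have hsub' : Ioo (max a l) 0 ⊆ {t | ¬ |F t| ≤ B} := fun t ht =>
    not_le.2 (hsub ⟨(le_max_right a l).trans_lt ht.1, ht.2⟩)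
  have hzero : volume.restrict (Ioo a 0) (Ioo (max a l) 0) = 0 := measure_mono_null hsub' hnull
  rw [Measure.restrict_apply measurableSet_Ioo,
    inter_eq_left.2 (Ioo_subset_Ioo (le_max_left a l) le_rfl), Real.volume_Ioo] at hzero
  have hpos : 0 < ENNReal.ofReal (0 - max a l) := ENNReal.ofReal_pos.2 (by
    have : max a l < 0 := max_lt ha hl0
    linarith)
  exact hpos.ne' hzero

/-! ### The pairing of one slice against a test field supported in a ball -/

/-- **Cauchy–Schwarz on a ball for one slice**: if `φ` is a test field supported in `B(x₀, r)` and
`∫_{B(x₀,r)} |u(t)|² ≤ E < ∞` (`t < 0`), then `|∫⟪u(t), φ⟫| ≤ √E · ‖φ‖_{L²}`. -/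
theorem abs_integral_inner_le_sqrt_mul_sqrt (hu : IsTypeIAncientMild C u) {t : ℝ} (ht : t < 0)
    {x₀ : EuclideanSpace ℝ (Fin 3)} {r : ℝ}
    {φ : EuclideanSpace ℝ (Fin 3) → EuclideanSpace ℝ (Fin 3)}
    (hφ : FunctionSpaces.IsTestFunctionOn (⊤ : Opens (EuclideanSpace ℝ (Fin 3))) φ)
    (hsupp : ∀ x, φ x ≠ 0 → x ∈ ball x₀ r) {E : ℝ≥0∞} (hEtop : E ≠ ⊤)
    (hE : ∫⁻ x in ball x₀ r, ‖u t x‖ₑ ^ 2 ≤ E) :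
    |∫ x, ⟪u t x, φ x⟫| ≤ Real.sqrt E.toReal * Real.sqrt (∫ x, ‖φ x‖ ^ 2) := by
  have hcu : Continuous (u t) := hu.continuous_slice ht
  have hcφ : Continuous φ := hφ.contDiff.continuous
  have hφcs : HasCompactSupport φ := hφ.hasCompactSupport
  set μB : Measure (EuclideanSpace ℝ (Fin 3)) := volume.restrict (ball x₀ r) with hμB
  haveI : IsFiniteMeasure μB := isFiniteMeasure_restrict.2 measure_ball_lt_top.ne
  -- `φ` vanishes off the ball
  have hφ0 : ∀ x, x ∉ ball x₀ r → φ x = 0 := fun x hx => by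
    by_contra h
    exact hx (hsupp x h)
  -- ### Step 1: `|∫⟪u, φ⟫| ≤ ∫ ‖u‖ ‖φ‖ = ∫_B ‖u‖ ‖φ‖`
  have hint1 : Integrable (fun x => ⟪u t x, φ x⟫) :=
    integrable_inner_of_continuous_of_hasCompactSupport hcu hcφ hφcs
  have hint2 : Integrable (fun x => ‖u t x‖ * ‖φ x‖) := by
    exact (hcu.norm.mul hcφ.norm).integrable_of_hasCompactSupport hφcs.norm.mul_left
  have h1 : |∫ x, ⟪u t x, φ x⟫| ≤ ∫ x, ‖u t x‖ * ‖φ x‖ := by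
    rw [← Real.norm_eq_abs]
    refine (norm_integral_le_integral_norm _).trans (integral_mono hint1.norm hint2 fun x => ?_)
    exact norm_inner_le_norm (u t x) (φ x)
  have h2 : ∫ x, ‖u t x‖ * ‖φ x‖ = ∫ x in ball x₀ r, ‖u t x‖ * ‖φ x‖ := by
    refine (setIntegral_eq_integral_of_forall_compl_eq_zero fun x hx => ?_).symm
    rw [hφ0 x hx, norm_zero, mul_zero]
  -- ### Step 2: Hölder on the ball
  obtain ⟨Cu, hCu⟩ := (isCompact_closedBall x₀ r).exists_bound_of_continuousOn hcu.continuousOn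
  obtain ⟨Cφ, hCφ⟩ := hcφ.bounded_above_of_compact_support hφcs
  have hmu : MemLp (u t) (ENNReal.ofReal 2) μB :=
    MemLp.of_bound hcu.aestronglyMeasurable Cu
      (ae_restrict_of_forall_mem measurableSet_ball fun x hx => hCu x (ball_subset_closedBall hx))
  have hmφ : MemLp φ (ENNReal.ofReal 2) μB :=
    MemLp.of_bound hcφ.aestronglyMeasurable Cφ (ae_of_all _ hCφ)
  have h3 := integral_mul_norm_le_Lp_mul_Lq (μ := μB) Real.HolderConjugate.two_two hmu hmφ
  -- ### Step 3: the two factors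
  have hpow2 : ∀ y : EuclideanSpace ℝ (Fin 3), ‖y‖ ^ (2 : ℝ) = ‖y‖ ^ (2 : ℕ) := fun y =>
    Real.rpow_two ‖y‖
  have hfac1 : ∫ a, ‖u t a‖ ^ (2 : ℝ) ∂μB ≤ E.toReal := by
    have e1 : ∫ a, ‖u t a‖ ^ (2 : ℝ) ∂μB = (∫⁻ a, ‖u t a‖ₑ ^ 2 ∂μB).toReal := by
      rw [integral_eq_lintegral_of_nonneg_ae (ae_of_all _ fun a => by positivity)
        ((hcu.norm.rpow_const fun _ => Or.inr (by norm_num)).aestronglyMeasurable)]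
      congr 1
      refine lintegral_congr fun a => ?_
      rw [hpow2, ENNReal.ofReal_pow (norm_nonneg _), ofReal_norm]
    rw [e1]
    exact ENNReal.toReal_mono hEtop hE
  have hfac2 : ∫ a, ‖φ a‖ ^ (2 : ℝ) ∂μB = ∫ x, ‖φ x‖ ^ 2 := by
    rw [hμB, setIntegral_eq_integral_of_forall_compl_eq_zero fun x hx => by
      rw [hφ0 x hx, norm_zero, Real.zero_rpow (by norm_num)]]
    exact integral_congr_ae (ae_of_all _ fun x => hpow2 (φ x))
  have hI1 : 0 ≤ ∫ a, ‖u t a‖ ^ (2 : ℝ) ∂μB := integral_nonneg fun _ => by positivity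
  have hI2 : 0 ≤ ∫ x, ‖φ x‖ ^ 2 := integral_nonneg fun _ => by positivity
  -- ### assembly
  calc |∫ x, ⟪u t x, φ x⟫| ≤ ∫ x in ball x₀ r, ‖u t x‖ * ‖φ x‖ := h1.trans h2.le
    _ ≤ (∫ a, ‖u t a‖ ^ (2 : ℝ) ∂μB) ^ (1 / (2 : ℝ)) * (∫ a, ‖φ a‖ ^ (2 : ℝ) ∂μB) ^ (1 / (2 : ℝ)) := h3
    _ ≤ E.toReal ^ (1 / (2 : ℝ)) * (∫ x, ‖φ x‖ ^ 2) ^ (1 / (2 : ℝ)) := by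
        rw [hfac2]
        exact mul_le_mul_of_nonneg_right (Real.rpow_le_rpow hI1 hfac1 (by norm_num))
          (Real.rpow_nonneg hI2 _)
    _ = Real.sqrt E.toReal * Real.sqrt (∫ x, ‖φ x‖ ^ 2) := by
        rw [Real.sqrt_eq_rpow, Real.sqrt_eq_rpow]

/-! ### The final datum is in the critical Morrey class, uniformly -/

/-- **The trace against a test field supported in a ball `B(x₀, r)` is bounded by
`√(Λ r) ‖φ‖_{L²}`** — for one member, given the uniform local energy bound. -/
theorem abs_trace_le_morrey (hu : IsTypeIAncientMild C u) {Λ : ℝ≥0}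
    {x₀ : EuclideanSpace ℝ (Fin 3)} {r : ℝ} (hr : 0 < r)
    (hball : ∀ᵐ t ∂(volume.restrict (Ioo (-r ^ 2) 0)),
      ∫⁻ x in ball x₀ r, ‖u t x‖ₑ ^ 2 ≤ ENNReal.ofReal r * Λ)
    {φ : EuclideanSpace ℝ (Fin 3) → EuclideanSpace ℝ (Fin 3)}
    (hφ : FunctionSpaces.IsTestFunctionOn (⊤ : Opens (EuclideanSpace ℝ (Fin 3))) φ)
    (hsupp : ∀ x, φ x ≠ 0 → x ∈ ball x₀ r) {L : ℝ}
    (hL : Tendsto (fun t => ∫ x, ⟪u t x, φ x⟫) (𝓝[<] 0) (𝓝 L)) :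
    |L| ≤ Real.sqrt (Λ * r) * Real.sqrt (∫ x, ‖φ x‖ ^ 2) := by
  have hr2 : -r ^ 2 < 0 := by nlinarith
  refine abs_le_of_tendsto_of_ae_abs_le hr2 hL ?_
  have hmem : ∀ᵐ t ∂(volume.restrict (Ioo (-r ^ 2) (0 : ℝ))), t ∈ Ioo (-r ^ 2) 0 :=
    ae_restrict_mem measurableSet_Ioo
  filter_upwards [hball, hmem] with t ht htI
  have hEtop : ENNReal.ofReal r * (Λ : ℝ≥0∞) ≠ ⊤ :=
    ENNReal.mul_ne_top ENNReal.ofReal_ne_top ENNReal.coe_ne_top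
  have h := abs_integral_inner_le_sqrt_mul_sqrt hu htI.2 hφ hsupp hEtop ht
  have e : (ENNReal.ofReal r * (Λ : ℝ≥0∞)).toReal = Λ * r := by
    rw [ENNReal.toReal_mul, ENNReal.toReal_ofReal hr.le, ENNReal.coe_toReal, mul_comm]
  rwa [e] at h

/-- **THE FINAL DATUM OF EVERY MEMBER OF `𝒟_{C,K}` LIES IN THE CRITICAL MORREY CLASS `M^{2,1}`,
with a constant depending on `K` only.** For every `K` there is `M ≥ 0` such that for every
Type-I constant `C`, every member `u ∈ 𝒟_{C,K}`, every ball `B(x₀, r)` and every test field `φ`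
supported in it, the trace value `L_φ = lim_{t→0⁻} ∫⟪u(t), φ⟫` (it exists:
`exists_tendsto_pairing_finalSlice`) satisfies `|L_φ| ≤ M √r ‖φ‖_{L²(ℝ³)}`. Equivalently
`u(0⁻) ∈ L²_loc` with `‖u(0⁻)‖_{L²(B(x₀,r))} ≤ M √r` for ALL `x₀` and `r > 0` — at the singular
points too: the scaling of `|x|⁻¹`. -/
theorem exists_trace_morrey_bound (K : ℝ) :
    ∃ M : ℝ, 0 ≤ M ∧ ∀ (C : ℝ) (u : ℝ → EuclideanSpace ℝ (Fin 3) → EuclideanSpace ℝ (Fin 3)),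
      IsTypeIAncientMild C u →
      (∀ s : ℝ, s < 0 → ∫⁻ x, ‖fderiv ℝ (u s) x‖ₑ ^ 2 ≤ ENNReal.ofReal (K / Real.sqrt (-s))) →
      ∀ (x₀ : EuclideanSpace ℝ (Fin 3)) (r : ℝ), 0 < r →
      ∀ φ : EuclideanSpace ℝ (Fin 3) → EuclideanSpace ℝ (Fin 3),
        FunctionSpaces.IsTestFunctionOn (⊤ : Opens (EuclideanSpace ℝ (Fin 3))) φ →
        (∀ x, φ x ≠ 0 → x ∈ ball x₀ r) →
        ∀ L : ℝ, Tendsto (fun t => ∫ x, ⟪u t x, φ x⟫) (𝓝[<] 0) (𝓝 L) →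
          |L| ≤ M * Real.sqrt r * Real.sqrt (∫ x, ‖φ x‖ ^ 2) := by
  obtain ⟨Λ, hΛ⟩ := ae_lintegral_ball_sq_le_unif K
  refine ⟨Real.sqrt Λ, Real.sqrt_nonneg _, fun C u hu hlaw x₀ r hr φ hφ hsupp L hL => ?_⟩
  have h := abs_trace_le_morrey hu hr (hΛ C u hu hlaw x₀ r hr) hφ hsupp hL
  rwa [Real.sqrt_mul (NNReal.coe_nonneg Λ)] at h

/-- **The trace of a member of the stratum is an `L²_loc` function at every point** (per-member
form): for `u ∈ 𝒟_{C,K}` there is `M` with `|L_φ| ≤ M √r ‖φ‖_{L²}` for every ball `B(x₀, r)` and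
every test field `φ` supported in it. -/
theorem exists_trace_morrey_bound_of_mem (hu : IsTypeIAncientMild C u)
    (hlaw : ∀ s : ℝ, s < 0 → ∫⁻ x, ‖fderiv ℝ (u s) x‖ₑ ^ 2 ≤ ENNReal.ofReal (K / Real.sqrt (-s))) :
    ∃ M : ℝ, 0 ≤ M ∧ ∀ (x₀ : EuclideanSpace ℝ (Fin 3)) (r : ℝ), 0 < r →
      ∀ φ : EuclideanSpace ℝ (Fin 3) → EuclideanSpace ℝ (Fin 3),
        FunctionSpaces.IsTestFunctionOn (⊤ : Opens (EuclideanSpace ℝ (Fin 3))) φ →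
        (∀ x, φ x ≠ 0 → x ∈ ball x₀ r) →
        ∀ L : ℝ, Tendsto (fun t => ∫ x, ⟪u t x, φ x⟫) (𝓝[<] 0) (𝓝 L) →
          |L| ≤ M * Real.sqrt r * Real.sqrt (∫ x, ‖φ x‖ ^ 2) := by
  obtain ⟨M, hM0, hM⟩ := exists_trace_morrey_bound K
  exact ⟨M, hM0, fun x₀ r hr φ hφ hsupp L hL => hM C u hu hlaw x₀ r hr φ hφ hsupp L hL⟩

/-- **The energy of the final datum in small balls is small, uniformly on `𝒟_{C,K}` and at every
centre**: `‖u(0⁻)‖²_{L²(B(x₀,r))} ≤ M² r → 0` as `r → 0`, in the distributional form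
`|L_φ| ≤ ε ‖φ‖_{L²}` for the test fields supported in `B(x₀, r)`, `r ≤ (ε/M)²`. No energy of the
final datum concentrates at a singular point. -/
theorem trace_small_on_small_balls (K : ℝ) {ε : ℝ} (hε : 0 < ε) :
    ∃ r₀ : ℝ, 0 < r₀ ∧ ∀ (C : ℝ) (u : ℝ → EuclideanSpace ℝ (Fin 3) → EuclideanSpace ℝ (Fin 3)),
      IsTypeIAncientMild C u →
      (∀ s : ℝ, s < 0 → ∫⁻ x, ‖fderiv ℝ (u s) x‖ₑ ^ 2 ≤ ENNReal.ofReal (K / Real.sqrt (-s))) →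
      ∀ (x₀ : EuclideanSpace ℝ (Fin 3)) (r : ℝ), 0 < r → r ≤ r₀ →
      ∀ φ : EuclideanSpace ℝ (Fin 3) → EuclideanSpace ℝ (Fin 3),
        FunctionSpaces.IsTestFunctionOn (⊤ : Opens (EuclideanSpace ℝ (Fin 3))) φ →
        (∀ x, φ x ≠ 0 → x ∈ ball x₀ r) →
        ∀ L : ℝ, Tendsto (fun t => ∫ x, ⟪u t x, φ x⟫) (𝓝[<] 0) (𝓝 L) →
          |L| ≤ ε * Real.sqrt (∫ x, ‖φ x‖ ^ 2) := by
  obtain ⟨M, hM0, hM⟩ := exists_trace_morrey_bound K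
  refine ⟨(ε / (M + 1)) ^ 2, by positivity, fun C u hu hlaw x₀ r hr hrle φ hφ hsupp L hL => ?_⟩
  have h := hM C u hu hlaw x₀ r hr φ hφ hsupp L hL
  have hI : 0 ≤ Real.sqrt (∫ x, ‖φ x‖ ^ 2) := Real.sqrt_nonneg _
  have hsr : Real.sqrt r ≤ ε / (M + 1) := by
    rw [← Real.sqrt_sq (by positivity : (0 : ℝ) ≤ ε / (M + 1))]
    exact Real.sqrt_le_sqrt hrle
  have hMr : M * Real.sqrt r ≤ ε := by
    calc M * Real.sqrt r ≤ M * (ε / (M + 1)) := mul_le_mul_of_nonneg_left hsr hM0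
      _ ≤ ε := by
          rw [mul_div_assoc']
          rw [div_le_iff₀ (by positivity)]
          nlinarith
  calc |L| ≤ M * Real.sqrt r * Real.sqrt (∫ x, ‖φ x‖ ^ 2) := h
    _ ≤ ε * Real.sqrt (∫ x, ‖φ x‖ ^ 2) := mul_le_mul_of_nonneg_right hMr hI

end Summit.NavierStokesRegularity.NavierStokesRegularity.Theorems.FiniteDissipationLiouville.Birth.Apex

end
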